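import Literature.NumberTheory.Irrationality.KrattenthalerZudilin2019.PiFourPiTwoForms
import HarnessLib

/-!
# Krattenthaler–Zudilin 2019, §4 eq. (8): the well-poised `₅F₄` summand — shifts, ratios, summability

Proofs-only file 3 of the eq. (8) chain (objects: `RFour`, `rFour` of `ZetaOddMinusPiPowers.lean`; route in
`EqEightCertificate.lean`). With `F(n,k) := R_n(n+1+k)` (the summand of `r_n = Σ_{u≥0} R_n(u+1)` re-indexed
past its `n` vanishing terms `u < n`):
* `RFour_shift` — the closed form `F(n,k) = 2^{8n}n!⁴(2n)!²·∏_{j<4n}(k+1+j) / ((4n)!·∏_{j<2n+1}(n+k+½+j)⁴)`;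
* `RFour_succ_eq_zero`, `hasSum_rFour_shift` — `R_n(u+1) = 0` for `u < n` and `Σ_k F(n,k) = r_n` (with
  `summable_RFour_shift`, from the bound `RFour_shift_le`: `0 ≤ F(n,k) ≤ 2^{16n+4}n!⁴(2n)!²/(k+1)⁴`);
* the three TERM RATIOS of the creative telescoping, in product form (no division):
  `RFour_ratio_n` (`F(n+1,k)·(4n+1)(4n+3)·T₃⁴ = F(n,k)·2⁷(n+1)⁵(2n+1)(k+4n+1)₄(n+k+½)⁴`,
  `T₃ = (3n+k+3/2)(3n+k+5/2)(3n+k+7/2)`), `RFour_ratio_nn` (index `n+2`), `RFour_ratio_k` (index `k+1`).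
[KrattenthalerZudilin2019, §4 eq. (8)]. HONEST FRAMING (cell pub-zeta5): systematic search; elementary
bookkeeping of an explicit rational function; nothing about `ζ(5)`. Theorems only; statement files untouched.
-/

open Finset Filter Topology

open scoped Nat

namespace Literature.NumberTheory.Irrationality.KrattenthalerZudilin2019

namespace EqEight

/-! ### The shifted summand `F(n,k) = R_n(n+1+k)` -/

/-- Closed form of `F(n,k) = R_n(n+1+k)`:
`2^{8n} n!⁴ (2n)!² ∏_{j<4n}(k+1+j) / ((4n)! ∏_{j<2n+1}(n+k+½+j)⁴)`. [cite: KrattenthalerZudilin2019, §4 (definition of R_n)] -/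
theorem RFour_shift (n k : ℕ) :
    RFour n ((n : ℝ) + 1 + k) = 2 ^ (8 * n) * (n ! : ℝ) ^ 4 * ((2 * n)! : ℝ) ^ 2
      * (∏ j ∈ range (4 * n), ((k : ℝ) + 1 + j))
      / (((4 * n)! : ℝ) * ∏ j ∈ range (2 * n + 1), ((n : ℝ) + k + 1 / 2 + j) ^ 4) := by
  unfold RFour
  have h1 : ∏ j ∈ range (4 * n), ((n : ℝ) + 1 + k - n + j) = ∏ j ∈ range (4 * n), ((k : ℝ) + 1 + j) :=
    prod_congr rfl fun j _ => by ring
  have h2 : ∏ j ∈ range (2 * n + 1), ((n : ℝ) + 1 + k - 1 / 2 + j) ^ 4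
      = ∏ j ∈ range (2 * n + 1), ((n : ℝ) + k + 1 / 2 + j) ^ 4 := prod_congr rfl fun j _ => by ring
  rw [h1, h2]

/-- `R_n(u+1) = 0` for `u < n` (the factor `j = n − 1 − u` of the numerator vanishes).
[cite: KrattenthalerZudilin2019, §4 ("the function R_n(t) vanishes at t = 1, 0, −1, …")] -/
theorem RFour_succ_eq_zero (n u : ℕ) (h : u < n) : RFour n ((u : ℝ) + 1) = 0 := by
  obtain ⟨d, rfl⟩ : ∃ d, n = u + 1 + d := ⟨n - u - 1, by omega⟩
  unfold RFour
  have hz : ∏ j ∈ range (4 * (u + 1 + d)), ((u : ℝ) + 1 - (u + 1 + d : ℕ) + j) = 0 := by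
    refine prod_eq_zero (i := d) (mem_range.mpr (by omega)) ?_
    push_cast; ring
  rw [hz, mul_zero, zero_div]

/-- `F(n,k) ≥ 0`. [cite: KrattenthalerZudilin2019, §4 (definition of R_n)] -/
theorem RFour_shift_nonneg (n k : ℕ) : 0 ≤ RFour n ((n : ℝ) + 1 + k) := by
  have h := SectionFour.RFour_succ_nonneg n (n + k)
  push_cast at h
  convert h using 2
  ring

/-- The positive denominator core `∏_{j<2n+1}(n+k+½+j)⁴ > 0`. [folklore] -/
private theorem den_core_pos (n k : ℕ) : 0 < ∏ j ∈ range (2 * n + 1), ((n : ℝ) + k + 1 / 2 + j) ^ 4 :=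
  prod_pos fun j _ => by positivity

/-- A polynomial majorant: `F(n,k) ≤ 2^{8n}n!⁴(2n)!²·2^{8n+4}/(k+1)⁴` (from `∏_{j<4n}(k+1+j) ≤ (k+1)^{4n}(4n)!`
and `∏_{j<2n+1}(n+k+½+j)⁴ ≥ ((k+1)/2)^{8n+4}`). [cite: KrattenthalerZudilin2019, §4 (definition of R_n)] -/
theorem RFour_shift_le (n k : ℕ) :
    RFour n ((n : ℝ) + 1 + k)
      ≤ 2 ^ (8 * n) * (n ! : ℝ) ^ 4 * ((2 * n)! : ℝ) ^ 2 * 2 ^ (8 * n + 4) / ((k : ℝ) + 1) ^ 4 := by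
  rw [RFour_shift]
  have hk : (0 : ℝ) < (k : ℝ) + 1 := by positivity
  -- numerator bound
  have hN : ∏ j ∈ range (4 * n), ((k : ℝ) + 1 + j) ≤ ((k : ℝ) + 1) ^ (4 * n) * ((4 * n)! : ℝ) := by
    calc ∏ j ∈ range (4 * n), ((k : ℝ) + 1 + j) ≤ ∏ j ∈ range (4 * n), (((k : ℝ) + 1) * ((j : ℝ) + 1)) := by
          refine prod_le_prod (fun j _ => by positivity) fun j _ => ?_
          nlinarith [mul_nonneg (Nat.cast_nonneg (α := ℝ) k) (Nat.cast_nonneg (α := ℝ) j)]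
      _ = ((k : ℝ) + 1) ^ (4 * n) * ((4 * n)! : ℝ) := by
          rw [prod_mul_distrib, prod_const, card_range, ← Finset.prod_range_add_one_eq_factorial]
          push_cast
          ring
  -- denominator bound
  have hD : ((k : ℝ) + 1) ^ (4 * (2 * n + 1))
      ≤ 2 ^ (4 * (2 * n + 1)) * ∏ j ∈ range (2 * n + 1), ((n : ℝ) + k + 1 / 2 + j) ^ 4 := by
    calc ((k : ℝ) + 1) ^ (4 * (2 * n + 1)) = ∏ j ∈ range (2 * n + 1), ((k : ℝ) + 1) ^ 4 := by
          rw [prod_const, card_range, ← pow_mul, mul_comm]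
      _ ≤ ∏ j ∈ range (2 * n + 1), (2 ^ 4 * ((n : ℝ) + k + 1 / 2 + j) ^ 4) := by
          refine prod_le_prod (fun j _ => by positivity) fun j _ => ?_
          rw [← mul_pow]
          gcongr
          have : (0 : ℝ) ≤ n := Nat.cast_nonneg n
          have : (0 : ℝ) ≤ j := Nat.cast_nonneg j
          linarith
      _ = 2 ^ (4 * (2 * n + 1)) * ∏ j ∈ range (2 * n + 1), ((n : ℝ) + k + 1 / 2 + j) ^ 4 := by
          rw [prod_mul_distrib, prod_const, card_range, ← pow_mul, mul_comm 4]
  have hDpos := den_core_pos n k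
  have hKpos : (0 : ℝ) ≤ 2 ^ (8 * n) * (n ! : ℝ) ^ 4 * ((2 * n)! : ℝ) ^ 2 := by positivity
  have hf : ((4 * n)! : ℝ) ≠ 0 := by positivity
  have hk4 : (0 : ℝ) < ((k : ℝ) + 1) ^ (4 * (2 * n + 1)) / 2 ^ (4 * (2 * n + 1)) := by positivity
  calc 2 ^ (8 * n) * (n ! : ℝ) ^ 4 * ((2 * n)! : ℝ) ^ 2 * (∏ j ∈ range (4 * n), ((k : ℝ) + 1 + j))
        / (((4 * n)! : ℝ) * ∏ j ∈ range (2 * n + 1), ((n : ℝ) + k + 1 / 2 + j) ^ 4)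
      ≤ 2 ^ (8 * n) * (n ! : ℝ) ^ 4 * ((2 * n)! : ℝ) ^ 2 * (((k : ℝ) + 1) ^ (4 * n) * ((4 * n)! : ℝ))
        / (((4 * n)! : ℝ) * ∏ j ∈ range (2 * n + 1), ((n : ℝ) + k + 1 / 2 + j) ^ 4) := by
        gcongr
    _ = 2 ^ (8 * n) * (n ! : ℝ) ^ 4 * ((2 * n)! : ℝ) ^ 2 * ((k : ℝ) + 1) ^ (4 * n)
        / ∏ j ∈ range (2 * n + 1), ((n : ℝ) + k + 1 / 2 + j) ^ 4 := by
        field_simp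
    _ ≤ 2 ^ (8 * n) * (n ! : ℝ) ^ 4 * ((2 * n)! : ℝ) ^ 2 * ((k : ℝ) + 1) ^ (4 * n)
        / (((k : ℝ) + 1) ^ (4 * (2 * n + 1)) / 2 ^ (4 * (2 * n + 1))) := by
        refine div_le_div_of_nonneg_left (by positivity) hk4 ?_
        rw [div_le_iff₀ (by positivity)]
        linarith [hD]
    _ = 2 ^ (8 * n) * (n ! : ℝ) ^ 4 * ((2 * n)! : ℝ) ^ 2 * 2 ^ (8 * n + 4) / ((k : ℝ) + 1) ^ (4 * n + 4) := by
        rw [show 4 * (2 * n + 1) = 8 * n + 4 by ring]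
        field_simp
        ring
    _ ≤ 2 ^ (8 * n) * (n ! : ℝ) ^ 4 * ((2 * n)! : ℝ) ^ 2 * 2 ^ (8 * n + 4) / ((k : ℝ) + 1) ^ 4 :=
        div_le_div_of_nonneg_left (by positivity) (by positivity)
          (pow_le_pow_right₀ (by linarith) (by omega))

/-- `Σ_k F(n,k)` converges. [cite: KrattenthalerZudilin2019, §4 (definition of r_n)] -/
theorem summable_RFour_shift (n : ℕ) : Summable fun k : ℕ => RFour n ((n : ℝ) + 1 + k) := by
  have h4 : Summable fun k : ℕ => (1 : ℝ) / ((k + 1 : ℕ) : ℝ) ^ 4 :=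
    (summable_nat_add_iff 1).mpr (Real.summable_one_div_nat_pow.mpr (by norm_num))
  have hC : Summable fun k : ℕ =>
      2 ^ (8 * n) * (n ! : ℝ) ^ 4 * ((2 * n)! : ℝ) ^ 2 * 2 ^ (8 * n + 4) / ((k : ℝ) + 1) ^ 4 := by
    refine ((h4.mul_left (2 ^ (8 * n) * (n ! : ℝ) ^ 4 * ((2 * n)! : ℝ) ^ 2 * 2 ^ (8 * n + 4))).congr
      fun k => ?_)
    push_cast
    ring
  exact Summable.of_nonneg_of_le (RFour_shift_nonneg n) (RFour_shift_le n) hC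

/-- **`r_n = Σ_{k≥0} F(n,k)`**: the defining series of `rFour n` re-indexed past its `n` vanishing terms.
[cite: KrattenthalerZudilin2019, §4 (definition of r_n)] -/
theorem hasSum_rFour_shift (n : ℕ) : HasSum (fun k : ℕ => RFour n ((n : ℝ) + 1 + k)) (rFour n) := by
  have hs := summable_RFour_shift n
  have hfun : (fun k : ℕ => RFour n ((((k + n : ℕ)) : ℝ) + 1)) = fun k : ℕ => RFour n ((n : ℝ) + 1 + k) := by
    funext k; congr 1; push_cast; ring
  have hs' : Summable fun u : ℕ => RFour n ((u : ℝ) + 1) := by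
    refine (summable_nat_add_iff n).mp ?_
    rw [hfun]; exact hs
  have hsplit := hs'.sum_add_tsum_nat_add n
  have hzero : ∑ i ∈ range n, RFour n ((i : ℝ) + 1) = 0 :=
    sum_eq_zero fun i hi => RFour_succ_eq_zero n i (mem_range.mp hi)
  rw [hzero, zero_add, hfun] at hsplit
  rw [rFour, ← hsplit]
  exact hs.hasSum

/-! ### Term ratios of the creative telescoping (product form) -/

/-- Numerator core, index `n+1`: four more top factors. [folklore] -/
private theorem num_succ (n k : ℕ) :
    ∏ j ∈ range (4 * (n + 1)), ((k : ℝ) + 1 + j)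
      = (∏ j ∈ range (4 * n), ((k : ℝ) + 1 + j))
          * (((k : ℝ) + 4 * n + 1) * ((k : ℝ) + 4 * n + 2) * ((k : ℝ) + 4 * n + 3) * ((k : ℝ) + 4 * n + 4)) := by
  rw [show 4 * (n + 1) = 4 * n + 1 + 1 + 1 + 1 by ring, prod_range_succ, prod_range_succ, prod_range_succ,
    prod_range_succ]
  push_cast
  ring

/-- Denominator core, index `n+1`, times the dropped bottom factor. [folklore] -/
private theorem den_succ (n k : ℕ) :
    (∏ j ∈ range (2 * (n + 1) + 1), ((((n + 1 : ℕ)) : ℝ) + k + 1 / 2 + j) ^ 4) * ((n : ℝ) + k + 1 / 2) ^ 4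
      = (∏ j ∈ range (2 * n + 1), ((n : ℝ) + k + 1 / 2 + j) ^ 4)
          * ((3 * (n : ℝ) + k + 3 / 2) * (3 * (n : ℝ) + k + 5 / 2) * (3 * (n : ℝ) + k + 7 / 2)) ^ 4 := by
  have h : ∏ j ∈ range (2 * n + 1 + 1 + 1 + 1), ((n : ℝ) + k + 1 / 2 + j) ^ 4
      = (∏ j ∈ range (2 * (n + 1) + 1), ((((n + 1 : ℕ)) : ℝ) + k + 1 / 2 + j) ^ 4)
          * ((n : ℝ) + k + 1 / 2) ^ 4 := by
    rw [prod_range_succ', show 2 * (n + 1) + 1 = 2 * n + 1 + 1 + 1 by ring]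
    push_cast
    congr 1
    · exact prod_congr rfl fun j _ => by ring
    · ring
  rw [← h, prod_range_succ, prod_range_succ, prod_range_succ]
  push_cast
  ring

/-- Numerator core, index `k+1`, times the dropped bottom factor. [folklore] -/
private theorem num_succ_k (n k : ℕ) :
    (∏ j ∈ range (4 * n), ((((k + 1 : ℕ)) : ℝ) + 1 + j)) * ((k : ℝ) + 1)
      = (∏ j ∈ range (4 * n), ((k : ℝ) + 1 + j)) * ((k : ℝ) + 4 * n + 1) := by
  have h : ∏ j ∈ range (4 * n + 1), ((k : ℝ) + 1 + j)
      = (∏ j ∈ range (4 * n), ((((k + 1 : ℕ)) : ℝ) + 1 + j)) * ((k : ℝ) + 1) := by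
    rw [prod_range_succ']
    push_cast
    congr 1
    · exact prod_congr rfl fun j _ => by ring
    · ring
  rw [← h, prod_range_succ]
  push_cast
  ring

/-- Denominator core, index `k+1`, times the dropped bottom factor. [folklore] -/
private theorem den_succ_k (n k : ℕ) :
    (∏ j ∈ range (2 * n + 1), ((n : ℝ) + (((k + 1 : ℕ)) : ℝ) + 1 / 2 + j) ^ 4) * ((n : ℝ) + k + 1 / 2) ^ 4
      = (∏ j ∈ range (2 * n + 1), ((n : ℝ) + k + 1 / 2 + j) ^ 4) * (3 * (n : ℝ) + k + 3 / 2) ^ 4 := by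
  have h : ∏ j ∈ range (2 * n + 1 + 1), ((n : ℝ) + k + 1 / 2 + j) ^ 4
      = (∏ j ∈ range (2 * n + 1), ((n : ℝ) + (((k + 1 : ℕ)) : ℝ) + 1 / 2 + j) ^ 4)
          * ((n : ℝ) + k + 1 / 2) ^ 4 := by
    rw [prod_range_succ']
    push_cast
    congr 1
    · exact prod_congr rfl fun j _ => by ring
    · ring
  rw [← h, prod_range_succ]
  push_cast
  ring

/-- **Ratio in `n`**: `F(n+1,k)·(4n+1)(4n+3)·((3n+k+3/2)(3n+k+5/2)(3n+k+7/2))⁴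
= F(n,k)·2⁷(n+1)⁵(2n+1)·(k+4n+1)(k+4n+2)(k+4n+3)(k+4n+4)·(n+k+½)⁴`.
[cite: KrattenthalerZudilin2019, §4 (definition of R_n)] -/
theorem RFour_ratio_n (n k : ℕ) :
    RFour (n + 1) ((((n + 1 : ℕ)) : ℝ) + 1 + k)
        * ((4 * (n : ℝ) + 1) * (4 * (n : ℝ) + 3)
            * ((3 * (n : ℝ) + k + 3 / 2) * (3 * (n : ℝ) + k + 5 / 2) * (3 * (n : ℝ) + k + 7 / 2)) ^ 4)
      = RFour n ((n : ℝ) + 1 + k)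
        * (2 ^ 7 * ((n : ℝ) + 1) ^ 5 * (2 * (n : ℝ) + 1)
            * (((k : ℝ) + 4 * n + 1) * ((k : ℝ) + 4 * n + 2) * ((k : ℝ) + 4 * n + 3) * ((k : ℝ) + 4 * n + 4))
            * ((n : ℝ) + k + 1 / 2) ^ 4) := by
  rw [RFour_shift, RFour_shift, num_succ]
  have ha : ((n : ℝ) + k + 1 / 2) ^ 4 ≠ 0 := by positivity
  have hD1 : ∏ j ∈ range (2 * (n + 1) + 1), ((((n + 1 : ℕ)) : ℝ) + k + 1 / 2 + j) ^ 4
      = (∏ j ∈ range (2 * n + 1), ((n : ℝ) + k + 1 / 2 + j) ^ 4)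
          * ((3 * (n : ℝ) + k + 3 / 2) * (3 * (n : ℝ) + k + 5 / 2) * (3 * (n : ℝ) + k + 7 / 2)) ^ 4
          / ((n : ℝ) + k + 1 / 2) ^ 4 := by
    rw [eq_div_iff ha, den_succ]
  rw [hD1]
  have hf1 : ((n + 1)! : ℝ) = ((n : ℝ) + 1) * (n ! : ℝ) := by
    rw [Nat.factorial_succ]; push_cast; ring
  have hf2 : ((2 * (n + 1))! : ℝ) = (2 * (n : ℝ) + 2) * (2 * (n : ℝ) + 1) * ((2 * n)! : ℝ) := by
    rw [show 2 * (n + 1) = 2 * n + 1 + 1 by ring, Nat.factorial_succ, Nat.factorial_succ]; push_cast; ring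
  have hf4 : ((4 * (n + 1))! : ℝ)
      = (4 * (n : ℝ) + 4) * (4 * (n : ℝ) + 3) * (4 * (n : ℝ) + 2) * (4 * (n : ℝ) + 1) * ((4 * n)! : ℝ) := by
    rw [show 4 * (n + 1) = 4 * n + 1 + 1 + 1 + 1 by ring, Nat.factorial_succ, Nat.factorial_succ,
      Nat.factorial_succ, Nat.factorial_succ]; push_cast; ring
  rw [hf1, hf2, hf4, show 8 * (n + 1) = 8 * n + 8 by ring, pow_add]
  have hD0 := (den_core_pos n k).ne'
  have hn4 : ((4 * n)! : ℝ) ≠ 0 := by positivity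
  have hq : (3 * (n : ℝ) + k + 3 / 2) * (3 * (n : ℝ) + k + 5 / 2) * (3 * (n : ℝ) + k + 7 / 2) ≠ 0 := by
    positivity
  field_simp
  ring

/-- **Ratio in `n`, two steps**: `F(n+2,k)·(4n+1)(4n+3)(4n+5)(4n+7)·(∏_{j=1}^{6}(3n+k+½+j))⁴
= F(n,k)·2¹⁴(n+1)⁵(n+2)⁵(2n+1)(2n+3)·∏_{i=1}^{8}(k+4n+i)·(n+k+½)⁴(n+k+3/2)⁴`.
[cite: KrattenthalerZudilin2019, §4 (definition of R_n)] -/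
theorem RFour_ratio_nn (n k : ℕ) :
    RFour (n + 2) ((((n + 2 : ℕ)) : ℝ) + 1 + k)
        * ((4 * (n : ℝ) + 1) * (4 * (n : ℝ) + 3) * (4 * (n : ℝ) + 5) * (4 * (n : ℝ) + 7)
            * ((3 * (n : ℝ) + k + 3 / 2) * (3 * (n : ℝ) + k + 5 / 2) * (3 * (n : ℝ) + k + 7 / 2)
                * (3 * (n : ℝ) + k + 9 / 2) * (3 * (n : ℝ) + k + 11 / 2) * (3 * (n : ℝ) + k + 13 / 2)) ^ 4)
      = RFour n ((n : ℝ) + 1 + k)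
        * (2 ^ 14 * ((n : ℝ) + 1) ^ 5 * ((n : ℝ) + 2) ^ 5 * (2 * (n : ℝ) + 1) * (2 * (n : ℝ) + 3)
            * (((k : ℝ) + 4 * n + 1) * ((k : ℝ) + 4 * n + 2) * ((k : ℝ) + 4 * n + 3) * ((k : ℝ) + 4 * n + 4)
                * ((k : ℝ) + 4 * n + 5) * ((k : ℝ) + 4 * n + 6) * ((k : ℝ) + 4 * n + 7) * ((k : ℝ) + 4 * n + 8))
            * ((n : ℝ) + k + 1 / 2) ^ 4 * ((n : ℝ) + k + 3 / 2) ^ 4) := by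
  have h1 := RFour_ratio_n n k
  have h2 := RFour_ratio_n (n + 1) k
  rw [show n + 1 + 1 = n + 2 from rfl] at h2
  push_cast at h1 h2 ⊢
  linear_combination
    ((4 * (n : ℝ) + 1) * (4 * (n : ℝ) + 3)
        * ((3 * (n : ℝ) + k + 3 / 2) * (3 * (n : ℝ) + k + 5 / 2) * (3 * (n : ℝ) + k + 7 / 2)) ^ 4) * h2
    + (2 ^ 7 * ((n : ℝ) + 1 + 1) ^ 5 * (2 * ((n : ℝ) + 1) + 1)
        * (((k : ℝ) + 4 * (n + 1) + 1) * ((k : ℝ) + 4 * (n + 1) + 2) * ((k : ℝ) + 4 * (n + 1) + 3)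
            * ((k : ℝ) + 4 * (n + 1) + 4))
        * (((n : ℝ) + 1) + k + 1 / 2) ^ 4) * h1

/-- **Ratio in `k`**: `F(n,k+1)·(k+1)(3n+k+3/2)⁴ = F(n,k)·(k+4n+1)(n+k+½)⁴`.
[cite: KrattenthalerZudilin2019, §4 (definition of R_n)] -/
theorem RFour_ratio_k (n k : ℕ) :
    RFour n ((n : ℝ) + 1 + (((k + 1 : ℕ)) : ℝ)) * (((k : ℝ) + 1) * (3 * (n : ℝ) + k + 3 / 2) ^ 4)
      = RFour n ((n : ℝ) + 1 + k) * (((k : ℝ) + 4 * n + 1) * ((n : ℝ) + k + 1 / 2) ^ 4) := by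
  rw [RFour_shift, RFour_shift]
  have hk1 : (k : ℝ) + 1 ≠ 0 := by positivity
  have ha : ((n : ℝ) + k + 1 / 2) ^ 4 ≠ 0 := by positivity
  have hN1 : ∏ j ∈ range (4 * n), ((((k + 1 : ℕ)) : ℝ) + 1 + j)
      = (∏ j ∈ range (4 * n), ((k : ℝ) + 1 + j)) * ((k : ℝ) + 4 * n + 1) / ((k : ℝ) + 1) := by
    rw [eq_div_iff hk1, num_succ_k]
  have hD1 : ∏ j ∈ range (2 * n + 1), ((n : ℝ) + (((k + 1 : ℕ)) : ℝ) + 1 / 2 + j) ^ 4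
      = (∏ j ∈ range (2 * n + 1), ((n : ℝ) + k + 1 / 2 + j) ^ 4) * (3 * (n : ℝ) + k + 3 / 2) ^ 4
          / ((n : ℝ) + k + 1 / 2) ^ 4 := by
    rw [eq_div_iff ha, den_succ_k]
  rw [hN1, hD1]
  have hD0 := (den_core_pos n k).ne'
  have hn4 : ((4 * n)! : ℝ) ≠ 0 := by positivity
  have hu : (3 * (n : ℝ) + k + 3 / 2) ^ 4 ≠ 0 := by positivity
  field_simp

end EqEight

end Literature.NumberTheory.Irrationality.KrattenthalerZudilin2019
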